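import Mathlib
import HarnessLib
import Summits.Langlands.Langlands.Theses.SkinnerWilesDefectOne
import Summits.Langlands.Langlands.Theorems.SkinnerWilesDefectOneSeedOfQuadraticBaseChangeS4Rewire
import Summits.Langlands.Langlands.Theorems.SkinnerWilesDefectOneEisensteinProModularSeedDistinguishedDescendsQ
import Summits.Langlands.Langlands.Theorems.SkinnerWilesDefectOneEisensteinProModularSeedInertSupplyPrimeSq
import Summits.Langlands.Langlands.Theorems.SkinnerWilesDefectOneEisensteinProModularSeedEisensteinPackageQ
import Summits.Langlands.Langlands.Theorems.SkinnerWilesDefectOneEisensteinProModularSeedRestrictTwistGaloisPackageNu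
import Summits.Langlands.Langlands.Theorems.SkinnerWilesDefectOneEisensteinProModularSeedCuspidalCohomologicalPoint

/-!
# Item `SeedOfQuadraticBaseChange` (stmt-Langlands-15158, route `SkinnerWilesDefectOne`):
# the closing composition, CONDITIONAL on the genuine regime and seven named facts

`SeedOfQuadraticBaseChange : QuadraticBaseChangeGalois → EisensteinProModularSeed` is the seed crux
`EisensteinProModularSeed` (stmt-Langlands-12920) with Langlands' quadratic base change GIVEN (the
route crux `QuadraticBaseChangeGalois`, stmt-Langlands-15156).  This file is the item's closing
composition — the seed's picked line `descend-raise-basechange`, run on the hypothesis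
`hQ : QuadraticBaseChangeGalois` by name — proved sorry-free MODULO exactly:

* the seven published NAMED FACTS of the line that are not base-change facts (stubs S2' and S5 land
  conditionally on them): `BillereyMenares2016_thm22_exists_newform`,
  `Hida2000_thm326_{exists_galoisRep, ordinary_unitRoot, inertia_of_level}`,
  `Gelbart1975_exists_cuspidalRepData_LAlgebraic` (`Literature/NumberTheory/EllipticCurves/…`),
  `bianchi_cuspidal_regularLAlgebraic_eigenclassExists`, `algebraicWeightEigenclass_continuousPoint`
  (`Literature/NumberTheory/Automorphic/BianchiCuspidalEigenclass.lean`) — taken as hypotheses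
  (conditional result, D-0014);
* ONE open statement, the GENUINE REGIME of the seed (`hgen` below, = the seed crux VERBATIM
  restricted to residual pairs whose ratio does NOT descend to an odd character of `Γ_ℚ` with
  `p ≥ 5`; the line lead's hand-back stub S6' `stub_genuineRegimeSeed`, truth unknown — Disproof
  §7D/§8F of the crux's standing disprover).  It is an explicit hypothesis, not a Literature fact.

On the odd-descended regime everything is a landed theorem of the tree: S1'
`stub_inertSupplyPrimeSq` (p92220) → S0 `stub_distinguishedDescendsQ` (p92288) → S2'
`stub_eisensteinPackageQ` (p94046, conditional) → S3-Nu `stub_restrictTwistGaloisPackageNu` (p90619)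
→ S4 FROM `hQ` ALONE `stub_quadraticBaseChangeTwist_of_quadraticBaseChangeGalois` (p94876, the
item-specific rewire: no base-change named fact in its cone) → S5 `stub_cuspidalCohomologicalPoint`
(p87504, conditional); `seed_of_descendsOdd_of_quadraticBaseChangeGalois` below is that chain.
The companion file `…SeedOfQuadraticBaseChangeCousinSplit` records that the genuine regime in turn
follows from the three open stubs of the lead's skeleton v4 (cousin graft: S7a
`stub_cousinGaloisPackage`, S7b `stub_cousinAutomorphic`, S6'' `stub_genuineNonCousinSeed`) over the
landed S5, so that either shape of the planners' promoted residual closes the item by composition.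
-/

set_option linter.dupNamespace false -- project-wide option (lakefile weak.linter.dupNamespace); `Summit.Langlands.Langlands` is the mandated namespace

noncomputable section

namespace Summit.Langlands.Langlands.Theorems.SkinnerWilesDefectOne.SeedOfQuadraticBaseChange

open Summit.Langlands.Langlands.Theses.SkinnerWilesDefectOne
open Summit.Langlands.Langlands.Theorems.SkinnerWilesDefectOne.EisensteinProModularSeed
open Literature.NumberTheory.Automorphic Literature.NumberTheory.GaloisRepresentations
open Literature.NumberTheory.Automorphic.BigHeckeGLn
open NumberField IsDedekindDomain IsLocalRing Filter Field

/-- **The odd-descended regime, given quadratic base change.**  For `F` imaginary quadratic, `p ≥ 5`,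
`O = 𝒪_{ℚ̄_p}`, ANY continuous `ρ : Γ_F → GL₂(ℚ̄_p)` with a residually upper-triangular integral
model `ρ₀`, unramified a.e. and `p`-distinguished at every `v ∣ p`, and a continuous unit-valued
`η : Γ_ℚ → ℚ̄_pˣ` with ODD reduction and the DESCENT relation `η̄(σ|_ℚ)χ̄_a(σ) = χ̄_b(σ)` on `Γ_F`:
granted `QuadraticBaseChangeGalois` and the seven named facts, the seed's conclusion holds for `ρ₀`
— an irreducible, level-controlled, oriented-ordinary, `p`-adically automorphic `r` with the same
ordered residual diagonal.  Chain S1' → S0 → S2' → S3-Nu → S4 (from `hQ`) → S5 of the line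
`descend-raise-basechange`, every link a landed theorem. -/
theorem seed_of_descendsOdd_of_quadraticBaseChangeGalois
    (hQ : QuadraticBaseChangeGalois)
    (f₁ : Literature.NumberTheory.EllipticCurves.BillereyMenares2016_thm22_exists_newform)
    (f₂ : Literature.NumberTheory.EllipticCurves.Hida2000_thm326_exists_galoisRep)
    (f₃ : Literature.NumberTheory.EllipticCurves.Hida2000_thm326_ordinary_unitRoot)
    (f₄ : Literature.NumberTheory.EllipticCurves.Hida2000_thm326_inertia_of_level)
    (f₅ : Literature.NumberTheory.EllipticCurves.Gelbart1975_exists_cuspidalRepData_LAlgebraic)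
    (e₁ : Literature.NumberTheory.Automorphic.bianchi_cuspidal_regularLAlgebraic_eigenclassExists)
    (e₂ : Literature.NumberTheory.Automorphic.algebraicWeightEigenclass_continuousPoint)
    (F : Type) [Field F] [NumberField F] (hF : IsTotallyComplex F) (hdeg : Module.finrank ℚ F = 2)
    (p : ℕ) [Fact p.Prime] (hp5 : 5 ≤ p) (O : ValuationSubring (PadicAlgCl p))
    (hO : O = (Valued.v : Valuation (PadicAlgCl p) NNReal).valuationSubring)
    (ρ : FramedGaloisRep F (PadicAlgCl p) 2) (ρ₀ : absoluteGaloisGroup F →* Matrix.GeneralLinearGroup (Fin 2) O)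
    (hunr : ∀ᶠ v in cofinite, ρ.IsUnramifiedAt v) (hmod : ρ.HasUpperTriangularIntegralModel ρ₀)
    (hdist : ∀ v : HeightOneSpectrum (𝓞 F), (p : 𝓞 F) ∈ v.asIdeal → IsPDistinguishedAt ρ₀ v)
    (η : absoluteGaloisGroup ℚ →ₜ* (PadicAlgCl p)ˣ)
    (hU : ∀ τ, Valued.v ((η τ : (PadicAlgCl p)ˣ) : PadicAlgCl p) = 1)
    (hD : ∀ σ : absoluteGaloisGroup F,
      Valued.v (((η (absGaloisRestrict ℚ F σ) : (PadicAlgCl p)ˣ) : PadicAlgCl p) *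
          ((ρ₀ σ).val 0 0 : PadicAlgCl p) - ((ρ₀ σ).val 1 1 : PadicAlgCl p)) < 1)
    (hodd : ∀ c : absoluteGaloisGroup ℚ, IsComplexConjugation (Rat.castHom ℝ) c →
      Valued.v (((η c : (PadicAlgCl p)ˣ) : PadicAlgCl p) + 1) < 1) :
    ∃ (𝒰 : TameLevel 2 F p) (r : FramedGaloisRep F (PadicAlgCl p) 2)
      (r₀ : absoluteGaloisGroup F →* Matrix.GeneralLinearGroup (Fin 2) O)
      (q : HeightOneSpectrum (𝓞 F)),
      r.toGaloisRep.IsIrreducible ∧ 𝒰.IsPadicallyAutomorphic r ∧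
      r.HasUpperTriangularIntegralModel r₀ ∧
      (∀ g, ((r₀ g).val 0 0 - (ρ₀ g).val 0 0 : O) ∈ maximalIdeal O ∧
        ((r₀ g).val 1 1 - (ρ₀ g).val 1 1 : O) ∈ maximalIdeal O) ∧
      (∃ k : ℕ, 2 ≤ k ∧ ∃ m : ℕ, 0 < m ∧ ∀ v : HeightOneSpectrum (𝓞 F), (p : 𝓞 F) ∈ v.asIdeal →
        ∃ Q : Matrix.GeneralLinearGroup (Fin 2) (PadicAlgCl p),
          Valued.v (Q.val 0 0) ≤ Valued.v (Q.val 1 0) ∧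
          ∀ σ, (Q⁻¹ * r.toLocal v σ * Q).val 1 0 = 0 ∧
            (σ ∈ absInertia (v.adicCompletion F) →
              (Q⁻¹ * r.toLocal v σ * Q).val 1 1 ^ m = 1 ∧
              (Q⁻¹ * r.toLocal v σ * Q).val 0 0 ^ m =
                algebraMap (Padic p) (PadicAlgCl p)
                  (((GaloisRep.cyclotomicCharacter (v.adicCompletion F) p σ).val : PadicInt p) :
                    Padic p) ^ ((k - 1) * m))) ∧
      (∀ v : HeightOneSpectrum (𝓞 F), v ≠ q → (p : 𝓞 F) ∉ v.asIdeal →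
        (∀ 𝔓 ∈ v.primesAbove, ∀ σ ∈ 𝔓.inertia (absoluteGaloisGroup F),
          ((ρ₀ σ).val 0 0 - 1 : O) ∈ maximalIdeal O ∧ ((ρ₀ σ).val 1 1 - 1 : O) ∈ maximalIdeal O) →
        v ∉ 𝒰.bad) := by
  -- S1': a level-raising prime `M ≡ -1 (mod p²)`, inert in `F`, with `η̄(Frob_M) = -1`
  obtain ⟨M, hMp, hMne, hMinert, hMunr, hMfrob, hMsq⟩ :=
    stub_inertSupplyPrimeSq F hF hdeg p hp5 η hU hodd
  -- S0: `p`-distinguishedness descends to `ℚ`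
  have hdistQ := stub_distinguishedDescendsQ F p O hO ρ ρ₀ hmod hdist η hU hD
  -- S2': the Eisenstein-congruent ordinary newform over `ℚ` (BM16 Thm 2.2) and its Galois package
  obtain ⟨k, ρ', ρ'₀, hk, hirr', hmod', hdiag', hord', hlev', hmodular⟩ :=
    stub_eisensteinPackageQ f₁ f₂ f₃ f₄ f₅ p hp5 O hO η M hU hodd hdistQ hMp hMne hMunr hMfrob hMsq
  -- S3-Nu: restrict to `Γ_F`, twist by the Teichmüller lift of `χ̄_a`, frames, level set `S`, `q`
  obtain ⟨r, r₀, ν, q, S, hν, hrν, hrirr, hrmod, hrdiag, hrord, hSfin, hSp, hSunr, hνS, hSlev⟩ :=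
    stub_restrictTwistGaloisPackageNu F hF hdeg p O hO ρ ρ₀ hunr hmod hdist η M k ρ' ρ'₀ hU hD hMp
      hMinert hk hirr' hmod' hdiag' hord' hlev'
  -- S2''s modularity clause over `ℚ`, then S4 from `hQ`: quadratic base change + twist
  obtain ⟨ι, π, T, hT, hTL, hTR, hcompat⟩ := hmodular (isCompact_glFiniteIntegralLevel_holds 2 ℚ)
  obtain ⟨πF, T', hT', hT'L, hT'R, hcompatF⟩ :=
    stub_quadraticBaseChangeTwist_of_quadraticBaseChangeGalois hQ F hF hdeg p
      (isCompact_glFiniteIntegralLevel_holds 2 ℚ) ι π T hT hTL hTR ρ' hcompat ν hν r hrν hrirr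
      S hSfin hSp hSunr hνS (isCompact_glFiniteIntegralLevel_holds 2 F)
  -- S5: the dictionary — a continuous `ℚ̄_p`-point of `𝕋(𝒰)`, `𝒰.bad = S`
  obtain ⟨𝒰, hbad, hpa⟩ :=
    stub_cuspidalCohomologicalPoint e₁ e₂ F hF hdeg p (isCompact_glFiniteIntegralLevel_holds 2 F) ι
      πF T' hT' hT'L hT'R S hSfin hSp r hcompatF
  exact ⟨𝒰, r, r₀, q, hrirr, hpa, hrmod, hrdiag, hrord, fun v hvq hvp hur => hbad ▸ hSlev v hvq hvp hur⟩

/-- **The item modulo the genuine regime** (closing composition of stmt-Langlands-15158, conditional).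
Granted the seven named facts `f₁ … f₅, e₁, e₂` (published theorems, Literature `def`s) and the
GENUINE-REGIME SEED `hgen` — the seed crux `EisensteinProModularSeed` VERBATIM under the extra
hypothesis that the residual pair is NOT odd-descended with `p ≥ 5` (the line lead's open stub S6'
`stub_genuineRegimeSeed`; an explicit hypothesis here, NOT a named fact: its truth is unknown) —
`SeedOfQuadraticBaseChange` holds: unfold, take `hQ : QuadraticBaseChangeGalois`, and split on the
regime; the odd-descended case is `seed_of_descendsOdd_of_quadraticBaseChangeGalois` (only `hunr`,
`hmod` and `p`-distinguishedness of the crux's hypotheses are used there), the complement is `hgen`. -/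
theorem seedOfQuadraticBaseChange_of_genuineRegimeSeed
    (f₁ : Literature.NumberTheory.EllipticCurves.BillereyMenares2016_thm22_exists_newform)
    (f₂ : Literature.NumberTheory.EllipticCurves.Hida2000_thm326_exists_galoisRep)
    (f₃ : Literature.NumberTheory.EllipticCurves.Hida2000_thm326_ordinary_unitRoot)
    (f₄ : Literature.NumberTheory.EllipticCurves.Hida2000_thm326_inertia_of_level)
    (f₅ : Literature.NumberTheory.EllipticCurves.Gelbart1975_exists_cuspidalRepData_LAlgebraic)
    (e₁ : Literature.NumberTheory.Automorphic.bianchi_cuspidal_regularLAlgebraic_eigenclassExists)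
    (e₂ : Literature.NumberTheory.Automorphic.algebraicWeightEigenclass_continuousPoint)
    (hgen : ∀ (F : Type) [Field F] [NumberField F], NumberField.IsTotallyComplex F → Module.finrank ℚ F = 2 →
      ∀ (p : ℕ) [Fact p.Prime], p ≠ 2 → ∀ (O : ValuationSubring (PadicAlgCl p)),
      O = (Valued.v : Valuation (PadicAlgCl p) NNReal).valuationSubring →
      ∀ (ρ : Literature.NumberTheory.GaloisRepresentations.FramedGaloisRep F (PadicAlgCl p) 2)
        (ρ₀ : Field.absoluteGaloisGroup F →* Matrix.GeneralLinearGroup (Fin 2) O),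
      ρ.toGaloisRep.IsIrreducible → (∀ᶠ v in Filter.cofinite, ρ.IsUnramifiedAt v) →
      ρ.HasUpperTriangularIntegralModel ρ₀ →
      (∃ k : ℕ, 2 ≤ k ∧ ∃ m : ℕ, 0 < m ∧ ∀ v : IsDedekindDomain.HeightOneSpectrum (NumberField.RingOfIntegers F), (p : NumberField.RingOfIntegers F) ∈ v.asIdeal →
        Literature.NumberTheory.GaloisRepresentations.IsPDistinguishedAt ρ₀ v ∧ ∃ Q : Matrix.GeneralLinearGroup (Fin 2) (PadicAlgCl p),
          Valued.v (Q.val 0 0) ≤ Valued.v (Q.val 1 0) ∧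
          ∀ σ, (Q⁻¹ * ρ.toLocal v σ * Q).val 1 0 = 0 ∧
            (σ ∈ Literature.NumberTheory.GaloisRepresentations.absInertia (v.adicCompletion F) →
              (Q⁻¹ * ρ.toLocal v σ * Q).val 1 1 ^ m = 1 ∧
              (Q⁻¹ * ρ.toLocal v σ * Q).val 0 0 ^ m =
                algebraMap (Padic p) (PadicAlgCl p)
                  (((Literature.NumberTheory.GaloisRepresentations.GaloisRep.cyclotomicCharacter (v.adicCompletion F) p σ).val : PadicInt p) :
                    Padic p) ^ ((k - 1) * m))) →
      ¬ (5 ≤ p ∧ ∃ η : Field.absoluteGaloisGroup ℚ →ₜ* (PadicAlgCl p)ˣ,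
      (∀ τ, Valued.v ((η τ : (PadicAlgCl p)ˣ) : PadicAlgCl p) = 1) ∧
      (∀ σ : Field.absoluteGaloisGroup F,
        Valued.v (((η (Literature.NumberTheory.GaloisRepresentations.absGaloisRestrict ℚ F σ) : (PadicAlgCl p)ˣ) : PadicAlgCl p) *
            ((ρ₀ σ).val 0 0 : PadicAlgCl p) - ((ρ₀ σ).val 1 1 : PadicAlgCl p)) < 1) ∧
      (∀ c : Field.absoluteGaloisGroup ℚ, Literature.NumberTheory.GaloisRepresentations.IsComplexConjugation (Rat.castHom ℝ) c →
        Valued.v (((η c : (PadicAlgCl p)ˣ) : PadicAlgCl p) + 1) < 1)) →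
      ∃ (𝒰 : Literature.NumberTheory.Automorphic.BigHeckeGLn.TameLevel 2 F p) (r : Literature.NumberTheory.GaloisRepresentations.FramedGaloisRep F (PadicAlgCl p) 2)
        (r₀ : Field.absoluteGaloisGroup F →* Matrix.GeneralLinearGroup (Fin 2) O)
        (q : IsDedekindDomain.HeightOneSpectrum (NumberField.RingOfIntegers F)),
        r.toGaloisRep.IsIrreducible ∧ 𝒰.IsPadicallyAutomorphic r ∧
        r.HasUpperTriangularIntegralModel r₀ ∧
        (∀ g, ((r₀ g).val 0 0 - (ρ₀ g).val 0 0 : O) ∈ IsLocalRing.maximalIdeal O ∧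
          ((r₀ g).val 1 1 - (ρ₀ g).val 1 1 : O) ∈ IsLocalRing.maximalIdeal O) ∧
        (∃ k : ℕ, 2 ≤ k ∧ ∃ m : ℕ, 0 < m ∧ ∀ v : IsDedekindDomain.HeightOneSpectrum (NumberField.RingOfIntegers F), (p : NumberField.RingOfIntegers F) ∈ v.asIdeal →
          ∃ Q : Matrix.GeneralLinearGroup (Fin 2) (PadicAlgCl p),
            Valued.v (Q.val 0 0) ≤ Valued.v (Q.val 1 0) ∧
            ∀ σ, (Q⁻¹ * r.toLocal v σ * Q).val 1 0 = 0 ∧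
              (σ ∈ Literature.NumberTheory.GaloisRepresentations.absInertia (v.adicCompletion F) →
                (Q⁻¹ * r.toLocal v σ * Q).val 1 1 ^ m = 1 ∧
                (Q⁻¹ * r.toLocal v σ * Q).val 0 0 ^ m =
                  algebraMap (Padic p) (PadicAlgCl p)
                    (((Literature.NumberTheory.GaloisRepresentations.GaloisRep.cyclotomicCharacter (v.adicCompletion F) p σ).val : PadicInt p) :
                      Padic p) ^ ((k - 1) * m))) ∧
        (∀ v : IsDedekindDomain.HeightOneSpectrum (NumberField.RingOfIntegers F), v ≠ q → (p : NumberField.RingOfIntegers F) ∉ v.asIdeal →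
          (∀ 𝔓 ∈ v.primesAbove, ∀ σ ∈ 𝔓.inertia (Field.absoluteGaloisGroup F),
            ((ρ₀ σ).val 0 0 - 1 : O) ∈ IsLocalRing.maximalIdeal O ∧ ((ρ₀ σ).val 1 1 - 1 : O) ∈ IsLocalRing.maximalIdeal O) →
          v ∉ 𝒰.bad)) :
    SeedOfQuadraticBaseChange := by
  unfold SeedOfQuadraticBaseChange
  intro hQ F _ _ hF hdeg p _ hp O hO ρ ρ₀ hirr hunr hmod hloc
  by_cases hP : (5 ≤ p ∧ ∃ η : absoluteGaloisGroup ℚ →ₜ* (PadicAlgCl p)ˣ,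
      (∀ τ, Valued.v ((η τ : (PadicAlgCl p)ˣ) : PadicAlgCl p) = 1) ∧
      (∀ σ : absoluteGaloisGroup F,
        Valued.v (((η (absGaloisRestrict ℚ F σ) : (PadicAlgCl p)ˣ) : PadicAlgCl p) *
            ((ρ₀ σ).val 0 0 : PadicAlgCl p) - ((ρ₀ σ).val 1 1 : PadicAlgCl p)) < 1) ∧
      (∀ c : absoluteGaloisGroup ℚ, IsComplexConjugation (Rat.castHom ℝ) c →
        Valued.v (((η c : (PadicAlgCl p)ˣ) : PadicAlgCl p) + 1) < 1))
  · obtain ⟨hp5, η, hU, hD, hodd⟩ := hP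
    have hdist : ∀ v : HeightOneSpectrum (𝓞 F), (p : 𝓞 F) ∈ v.asIdeal → IsPDistinguishedAt ρ₀ v := by
      obtain ⟨k₀, -, m₀, -, hloc'⟩ := hloc
      exact fun v hv => (hloc' v hv).1
    exact seed_of_descendsOdd_of_quadraticBaseChangeGalois hQ f₁ f₂ f₃ f₄ f₅ e₁ e₂ F hF hdeg p hp5 O hO
      ρ ρ₀ hunr hmod hdist η hU hD hodd
  · exact hgen F hF hdeg p hp O hO ρ ρ₀ hirr hunr hmod hloc hP

end Summit.Langlands.Langlands.Theorems.SkinnerWilesDefectOne.SeedOfQuadraticBaseChange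

end
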